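import Summits.Ventures.QEC.Theorems.BB144DistanceCertificateLowerZ
import Summits.Ventures.QEC.Census.CertBZInfoSets
import Summits.Ventures.QEC.Theorems.BB144DistanceCertificateLowerZKernel
import Summits.Ventures.QEC.Census.BB.BB144.BZPlaneEnumZ00
import Summits.Ventures.QEC.Census.BB.BB144.BZPlaneEnumZ01
import Summits.Ventures.QEC.Census.BB.BB144.BZPlaneEnumZ02
import Summits.Ventures.QEC.Census.BB.BB144.BZPlaneEnumZ03
import Summits.Ventures.QEC.Census.BB.BB144.BZPlaneEnumZ04
import Summits.Ventures.QEC.Census.BB.BB144.BZPlaneEnumZ05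
import Summits.Ventures.QEC.Census.BB.BB144.BZPlaneEnumZ06
import Summits.Ventures.QEC.Census.BB.BB144.BZPlaneEnumZ07
import Summits.Ventures.QEC.Census.BB.BB144.BZPlaneEnumZ08
import Summits.Ventures.QEC.Census.BB.BB144.BZPlaneEnumZ09
import Summits.Ventures.QEC.Census.BB.BB144.BZPlaneEnumZ10
import Summits.Ventures.QEC.Census.BB.BB144.BZPlaneEnumZ11
import Summits.Ventures.QEC.Census.BB.BB144.BZPlaneEnumZ12
import Summits.Ventures.QEC.Census.BB.BB144.BZPlaneEnumZ13
import Summits.Ventures.QEC.Census.BB.BB144.BZPlaneEnumZ14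
import Summits.Ventures.QEC.Census.BB.BB144.BZAutInfoSetsZ1
import Summits.Ventures.QEC.Census.BB.BB144.BZAutBoundsZ
import Summits.Ventures.QEC.Theses.BB144DistanceCertificate
import HarnessLib

/-!
# Route BB144DistanceCertificate, item NoZLogicalBelowTwelve (stmt-Ventures-19772): every `Z`-logical of the gross
# code `BB.bb144` has weight `≥ 12`

The closer of the `[[144,12,12]]` lower bound, path (b) of record (method `bz_aut`, certificate
`cert/alt-bzaut/BB144.bzaut.certA.json` `7c1e929a…`): the fifteen representative Brouwer–Zimmermann blocks of the
`Z` side are assembled from the verdict files — per block two information-set facts `autSysZ_b_i` (qec-search-7,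
KERNEL), the two enumeration verdicts as ONE kernel conjunction `enumZk_b` (lane-parallel replay
`Census/CertBZPlane*.lean`, files `Census/BB/BB144/BZPlaneEnumZ00 … 14.lean`, every segment `decide +kernel`;
qec-type-01, blocks 8–14 filed by qec-search-10) and the relative-rank bound `autBoundZ_b` (KERNEL) — by
`DistCert.bzZBlock_of_parts` (qec-search-7, `Census/CertBZInfoSets.lean`), fed to `lowerZ_of_blocks_kernel`
(qec-type-10, `Theorems/BB144DistanceCertificateLowerZKernel.lean`: structural checks, the 72 translation transports
of type-07/type-12, type-12's TABULATED kernel label cover `coverAutTabOK_bb144`), and transported to the typed code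
`BB.bb144` by type-05's `BB.Code.zLowerBound_of_flat` through the kernel-checked index identity.
TIER: KERNEL-std — axioms ⊆ {propext, Classical.choice, Quot.sound} for every declaration (REVISION 2026-08-27 per
director-qec R23 amended: the original proof, accepted as p477850-lineage with `native_decide` enumeration verdicts
the per-matrix native verdicts and the probing cover, is replaced; NAMES AND STATEMENTS UNCHANGED).
-/

namespace Summit.Ventures.QEC.Census.BB144

open Matrix Literature.InformationTheory.QuantumCodes Literature.InformationTheory.QuantumCodes.BB

/-- One representative block from its five parts (2 information-set facts, 2 enumeration verdicts, 1 bound). -/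
theorem blockZ_ok (b : ℕ) {blk : BZBlock} (hb : bzAutData.sideZ.blocks[b]? = some blk) (hm : blk.mats.length = 2)
    (hs0 : cert.bzZSys bzAutData b 0 = true) (hs1 : cert.bzZSys bzAutData b 1 = true)
    (he0 : cert.bzZEnum bzAutData b 0 = true) (he1 : cert.bzZEnum bzAutData b 1 = true)
    (hbd : cert.bzZBound bzAutData b = true) : cert.bzZBlock bzAutData b = true :=
  cert.bzZBlock_of_parts bzAutData hb hm
    (fun i hi => by interval_cases i <;> assumption) (fun i hi => by interval_cases i <;> assumption) hbd

/-- **All fifteen representative `Z` blocks replay** (from the 30 information sets + 15 kernel enumeration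
conjunctions + 15 bounds; KERNEL). -/
theorem blocks_ok : ∀ b : ℕ, b < bzAutData.sideZ.blocks.length → cert.bzZBlock bzAutData b = true := by
  intro b hb
  change b < 15 at hb
  interval_cases b
  · exact blockZ_ok 0 (blk := bzAutBlockZ0) rfl rfl autSysZ_0_0 autSysZ_0_1 enumZk_0.1 enumZk_0.2 autBoundZ_0
  · exact blockZ_ok 1 (blk := bzAutBlockZ1) rfl rfl autSysZ_1_0 autSysZ_1_1 enumZk_1.1 enumZk_1.2 autBoundZ_1
  · exact blockZ_ok 2 (blk := bzAutBlockZ2) rfl rfl autSysZ_2_0 autSysZ_2_1 enumZk_2.1 enumZk_2.2 autBoundZ_2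
  · exact blockZ_ok 3 (blk := bzAutBlockZ3) rfl rfl autSysZ_3_0 autSysZ_3_1 enumZk_3.1 enumZk_3.2 autBoundZ_3
  · exact blockZ_ok 4 (blk := bzAutBlockZ4) rfl rfl autSysZ_4_0 autSysZ_4_1 enumZk_4.1 enumZk_4.2 autBoundZ_4
  · exact blockZ_ok 5 (blk := bzAutBlockZ5) rfl rfl autSysZ_5_0 autSysZ_5_1 enumZk_5.1 enumZk_5.2 autBoundZ_5
  · exact blockZ_ok 6 (blk := bzAutBlockZ6) rfl rfl autSysZ_6_0 autSysZ_6_1 enumZk_6.1 enumZk_6.2 autBoundZ_6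
  · exact blockZ_ok 7 (blk := bzAutBlockZ7) rfl rfl autSysZ_7_0 autSysZ_7_1 enumZk_7.1 enumZk_7.2 autBoundZ_7
  · exact blockZ_ok 8 (blk := bzAutBlockZ8) rfl rfl autSysZ_8_0 autSysZ_8_1 enumZk_8.1 enumZk_8.2 autBoundZ_8
  · exact blockZ_ok 9 (blk := bzAutBlockZ9) rfl rfl autSysZ_9_0 autSysZ_9_1 enumZk_9.1 enumZk_9.2 autBoundZ_9
  · exact blockZ_ok 10 (blk := bzAutBlockZ10) rfl rfl autSysZ_10_0 autSysZ_10_1 enumZk_10.1 enumZk_10.2 autBoundZ_10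
  · exact blockZ_ok 11 (blk := bzAutBlockZ11) rfl rfl autSysZ_11_0 autSysZ_11_1 enumZk_11.1 enumZk_11.2 autBoundZ_11
  · exact blockZ_ok 12 (blk := bzAutBlockZ12) rfl rfl autSysZ_12_0 autSysZ_12_1 enumZk_12.1 enumZk_12.2 autBoundZ_12
  · exact blockZ_ok 13 (blk := bzAutBlockZ13) rfl rfl autSysZ_13_0 autSysZ_13_1 enumZk_13.1 enumZk_13.2 autBoundZ_13
  · exact blockZ_ok 14 (blk := bzAutBlockZ14) rfl rfl autSysZ_14_0 autSysZ_14_1 enumZk_14.1 enumZk_14.2 autBoundZ_14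

/-- **The flat lower bound**: every non-trivial `Z`-logical of the certificate's code has weight `≥ 12` (KERNEL:
type-12's tabulated cover via `lowerZ_of_blocks_kernel`). -/
theorem twelve_le (w : Fin cert.n → ZMod 2) (hw : rowMatrix cert.n cert.HX *ᵥ w = 0)
    (hw' : w ∉ rowSpace (rowMatrix cert.n cert.HZ)) : 12 ≤ hammingNorm w :=
  lowerZ_of_blocks_kernel blocks_ok w hw hw'

/-- **Item NoZLogicalBelowTwelve, PROVED** (tier KERNEL-std, axioms standard): every `Z`-type logical operator of
`BB.bb144` has Hamming weight `≥ 12`. -/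
theorem noZLogicalBelowTwelve_proof : Summit.Ventures.QEC.Theses.BB144DistanceCertificate.NoZLogicalBelowTwelve :=
  BB.bb144.zLowerBound_of_flat (D := flatCode) HX_eq_flat HZ_eq_flat twelve_le

end Summit.Ventures.QEC.Census.BB144
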